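import Summits.Ventures.CertifiedManyBodySolver.Upper.IntervalReaderSourcedTwoFieldNode
import Summits.Ventures.CertifiedManyBodySolver.Upper.IntervalReaderEmbedClaimNode

/-!
# Ventures/CertifiedManyBodySolver — Upper/IntervalReaderZeroFieldDerived.lean: the ZERO-FIELD energy rows AS THE
# READER DERIVES THEM (`E0 = μ̃ + κ·X`), merge and embed layouts
(part 40 of the Theorem-H1′ package; parts 32 / 35 state the zero-field rows from an `h = 0` sweep; parts 36–39 the
observable rows and the nine- and eleven-conjunct nodes)

HONEST FRAMING: first certified bounds; not a superconductivity verdict; every number certified (two readers)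
or labelled float.  A zero-field energy window of a certified finite-box vector is a pair of certified variational
statements about ONE vector; never a sign of order, never an order-parameter word (LADDER v1.17 (i)).  This file
composes already-landed theorems; it certifies no number and moves no row.

THE GAP IT CLOSES (this desk's precision P16 on parts 32/35).  Parts 32/35 take the zero-field rows
`e0_lo·ab ≤ Re⟨ψ, A_C(μ,0) ψ⟩ ≤ e0_hi·ab` from the bytes of an `H̃₀`-sweep — ird-3's automaton at field `0`.  The
reader of record never runs that sweep: `l3core-sgf` (`sgf_read.py` l.629–636, block `JOB_OBS=1`) DERIVES
`E_zero_field = μ̃ + κ·X` by interval arithmetic from the PHASE-A enclosure `μ̃ ∈ [μ_lo, μ_hi]` of the `H̃`-sweep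
(field `h`) and the enclosure `X ∈ [x_lo, x_hi]` of the `xpair_model` sweep (the transformed pair word, a pure
one-body word: `sgf_model` tables at `(M, U, μ) = (𝒳, 0, 0)`), then prints the outward `2⁻⁴⁰` dyadics of
`E_zero_field/ab` as the node literals.  The dictionary:

* `w5Nambu_zero_sub_orb` — the W5 Nambu matrix is AFFINE in the field: `𝓗(μ,0) − 𝓗(μ,s) = s·𝒴` entrywise
  (`𝒴` = the pair blocks `−(w_xy + w_yx)`, zero diagonal blocks);
* `gaugedNambu_zero_eq_add_smul` — hence `𝓗^ḡ(μ,0) = 𝓗^ḡ(μ,h) + κ·(𝓗^ḡ(μ,0) − 𝓗^ḡ(μ,c))` whenever `κ·c = h`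
  (the record: `c = 1/√2` makes `𝒳 := 𝓗^ḡ(μ,0) − 𝓗^ḡ(μ,c)` the code's integer pair table, `κ = h·√2` the certificate's
  `kappa`, e.g. `3/7` for `h = (3/14)√2`);
* **`conjTranspose_dWaveSourceOpenBox_zero_eq`** — the operator identity
  `S′ᴴ A_C(μ,0) S′ = S′ᴴ A_C(μ,h) S′ + κ·dΓ(𝒳)` (`gaugedShiba'_conjTranspose_conj_dWaveSourceOpenBox` twice + `dΓ` linear);
* **`zeroFieldWindow_of_reader_derived`** (merge layout) — bytes of the `H̃`-sweep with the four corner tests of its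
  hull `[μ_lo, μ_hi]`, bytes of the `𝒳`-sweep with the four corner tests of `[x_lo, x_hi]`, the `Nrm` sweep, `0 ≤ κ`,
  `κ·c = h`, and the two by-value literal tests `E0_lo ≤ μ_lo + κ·x_lo`, `μ_hi + κ·x_hi ≤ E0_hi` ⟹
  `E0_lo·Re⟨ψ̃,ψ̃⟩ ≤ Re⟨ψ̃, S′ᴴ A_C(μ,0) S′ ψ̃⟩ ≤ E0_hi·Re⟨ψ̃,ψ̃⟩` — exactly the `h0lo`/`h0hi` rows parts 37 / 39 take;
* **`zeroFieldWindow_of_embedReader_derived`** — the same from the EMBED-layout bytes (dilated tables, parts 33–35).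

Inputs outside the bytes, unchanged: the contractions (kit), the machine premises (A1)/(A2), the code tables by value
(`xpair_model` = ird-3's automaton at `(𝒳, 0, 0)`), the corner / literal tests by value, `κ·c = h` by value.
-/

noncomputable section

-- The dilated orbital type `Orb (Orb Λ)` is a twice-nested `Lex` synonym (see part 35).
set_option synthInstance.maxSize 1024

open Matrix Finset WithLp
open scoped BigOperators ComplexOrder Matrix.Norms.L2Operator

namespace Summit.Ventures.CertifiedManyBodySolver.Upper.IntervalReader

open Literature.MathematicalPhysics.QuantumLattice
open Literature.MathematicalPhysics.QuantumLattice.JordanWigner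
open Literature.MathematicalPhysics.QuantumLattice.JWEmbed
open Literature.MathematicalPhysics.QuantumLattice.TwoCluster (HasParity)

/-! ## §Q1  The W5 Nambu matrix is affine in the field -/

section Affine

variable {a b : ℕ}

/-- **`𝓗(μ,0) − 𝓗(μ,s) = s·𝒴`** on orbitals: zero on the diagonal spin blocks, `−s·(w_xy + w_yx)` on both
off-diagonal blocks (`w` = `dWaveBoxPairWeight`, real). -/
theorem w5Nambu_zero_sub_orb (μ s : ℝ) (x y : Fin a ×ₗ Fin b) (σ σ' : Fin 2) :
    w5Nambu a b μ 0 (orb x σ) (orb y σ') - w5Nambu a b μ s (orb x σ) (orb y σ') =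
      (s : ℂ) * (if σ = σ' then 0 else -(dWaveBoxPairWeight a b (x, y) + dWaveBoxPairWeight a b (y, x))) := by
  rw [w5Nambu, w5Nambu, bdgNambuMatrix_orb_orb, bdgNambuMatrix_orb_orb]
  have hreal : ∀ u v : Fin a ×ₗ Fin b, star (dWaveBoxPairWeight a b (u, v)) = dWaveBoxPairWeight a b (u, v) :=
    fun u v => star_dWaveBoxPairWeight a b _
  fin_cases σ <;> fin_cases σ' <;> simp [hreal] <;> ring

/-- **`𝓗^ḡ(μ,0) = 𝓗^ḡ(μ,h) + κ·(𝓗^ḡ(μ,0) − 𝓗^ḡ(μ,c))`** for `κ·c = h` (any gauge `g`). -/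
theorem gaugedNambu_zero_eq_add_smul (μ h c κ : ℝ) (hκc : κ * c = h) (g : Orb (Fin a ×ₗ Fin b) → ℂ) :
    (Matrix.of fun i j => star (g i) * g j * w5Nambu a b μ 0 i j) =
      (Matrix.of fun i j => star (g i) * g j * w5Nambu a b μ h i j) +
        (κ : ℂ) • (Matrix.of fun i j => star (g i) * g j * (w5Nambu a b μ 0 i j - w5Nambu a b μ c i j)) := by
  ext i j
  simp only [Matrix.add_apply, Matrix.smul_apply, Matrix.of_apply, smul_eq_mul]
  have h0h : w5Nambu a b μ 0 i j - w5Nambu a b μ h i j = (h : ℂ) * (if (ofLex i).2 = (ofLex j).2 then 0 else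
      -(dWaveBoxPairWeight a b ((ofLex i).1, (ofLex j).1) + dWaveBoxPairWeight a b ((ofLex j).1, (ofLex i).1))) :=
    w5Nambu_zero_sub_orb μ h (ofLex i).1 (ofLex j).1 (ofLex i).2 (ofLex j).2
  have h0c : w5Nambu a b μ 0 i j - w5Nambu a b μ c i j = (c : ℂ) * (if (ofLex i).2 = (ofLex j).2 then 0 else
      -(dWaveBoxPairWeight a b ((ofLex i).1, (ofLex j).1) + dWaveBoxPairWeight a b ((ofLex j).1, (ofLex i).1))) :=
    w5Nambu_zero_sub_orb μ c (ofLex i).1 (ofLex j).1 (ofLex i).2 (ofLex j).2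
  have hh : (h : ℂ) = (κ : ℂ) * (c : ℂ) := by rw [← Complex.ofReal_mul, hκc]
  rw [hh] at h0h
  linear_combination (star (g i) * g j) * h0h - (star (g i) * g j) * (κ : ℂ) * h0c

/-- **The operator identity behind `E0 = μ̃ + κ·X`**: `S′ᴴ A_C(μ,0) S′ = S′ᴴ A_C(μ,h) S′ + κ·dΓ(𝒳)`,
`𝒳 = 𝓗^ḡ(μ,0) − 𝓗^ḡ(μ,c)`, for `κ·c = h` and `|g| = 1`. [cite: Lieb1989, proof of Theorem 2] -/
theorem conjTranspose_dWaveSourceOpenBox_zero_eq (U μ h c κ : ℝ) (hκc : κ * c = h)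
    {g : Orb (Fin a ×ₗ Fin b) → ℂ} (hg : ∀ i, ‖g i‖ = 1) :
    (partialParticleHole (spinDownOrbitals : Finset (Orb (Fin a ×ₗ Fin b))) * orbitalPhase g)ᴴ *
        dWaveSourceOpenBox a b U μ 0 * (partialParticleHole (spinDownOrbitals : Finset (Orb (Fin a ×ₗ Fin b))) * orbitalPhase g) =
      (partialParticleHole (spinDownOrbitals : Finset (Orb (Fin a ×ₗ Fin b))) * orbitalPhase g)ᴴ *
          dWaveSourceOpenBox a b U μ h * (partialParticleHole (spinDownOrbitals : Finset (Orb (Fin a ×ₗ Fin b))) * orbitalPhase g) +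
        (κ : ℂ) • dGamma (Matrix.of fun i j => star (g i) * g j * (w5Nambu a b μ 0 i j - w5Nambu a b μ c i j)) := by
  rw [gaugedShiba'_conjTranspose_conj_dWaveSourceOpenBox a b U μ 0 hg,
    gaugedShiba'_conjTranspose_conj_dWaveSourceOpenBox a b U μ h hg]
  change dGamma (Matrix.of fun i j => star (g i) * g j * w5Nambu a b μ 0 i j) - _ + _ =
    dGamma (Matrix.of fun i j => star (g i) * g j * w5Nambu a b μ h i j) - _ + _ + _
  rw [gaugedNambu_zero_eq_add_smul μ h c κ hκc g, dGamma_add, dGamma_smul]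
  abel

/-- `𝒳 = 𝓗^ḡ(μ,0) − 𝓗^ḡ(μ,c)` is symmetric for a real sign gauge `g i = ±1`. -/
theorem gaugedNambuDiff_symm_of_sign (μ c : ℝ) {g : Orb (Fin a ×ₗ Fin b) → ℂ} (hg : ∀ i, g i = 1 ∨ g i = -1)
    (i j : Orb (Fin a ×ₗ Fin b)) :
    (Matrix.of fun i j => star (g i) * g j * (w5Nambu a b μ 0 i j - w5Nambu a b μ c i j)) i j =
      (Matrix.of fun i j => star (g i) * g j * (w5Nambu a b μ 0 i j - w5Nambu a b μ c i j)) j i := by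
  have hreal : ∀ i, star (g i) = g i := fun i => by
    rcases hg i with h1 | h1 <;> simp [h1]
  rw [Matrix.of_apply, Matrix.of_apply, hreal, hreal, bdgNambuMatrix_dWave_symm μ 0 i j,
    bdgNambuMatrix_dWave_symm μ c i j]
  ring

end Affine

/-! ## §Q2  The derived zero-field window, merge layout -/

section Merge

variable {a b D : ℕ}

/-- **`E0 = μ̃ + κ·X` from the bytes, merge layout** (producers' frame, real sign gauge `g i = ±1`).  Hypotheses: the
`H̃`-sweep (field `h`) with the four corner tests of its hull `[μ_lo, μ_hi]`; the `𝒳`-sweep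
(`𝒳 = 𝓗^ḡ(μ,0) − 𝓗^ḡ(μ,c)`, tables at `(𝒳, 0, 0)`) with the four corner tests of `[x_lo, x_hi]`; the shared `Nrm`
sweep; `κ·c = h`, `0 ≤ κ`; the literal tests.  Conclusion: the zero-field rows `h0lo`/`h0hi` of parts 37 / 39 for
`ψ̃ = toSpinVec⁻¹Ψ` (`E0_lo`, `E0_hi` totals, the row's `e0lo·ab`, `e0hi·ab`). -/
theorem zeroFieldWindow_of_reader_derived (U μ h : ℝ) {g : Orb (Fin a ×ₗ Fin b) → ℂ}
    (hg : ∀ i, g i = 1 ∨ g i = -1) (e : Fin (a * b) ≃ (Fin a ×ₗ Fin b))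
    (he : ∀ i j, e i < e j ↔ i < j) (A : Fin (a * b) → MPSTensor 4 D) (l r : Fin D → ℂ)
    (κ : Fin (a * b) → ℝ) (hκ0 : ∀ k, 0 ≤ κ k)
    (hκ : ∀ k (z : EuclideanSpace ℂ (Fin D)), ∑ s, ‖toLp 2 (A k s *ᵥ ofLp z)‖ ^ 2 ≤ κ k * ‖z‖ ^ 2)
    -- the reader's scalars: `κ·c = h` (record: `c = 1/√2`, `κ` = the certificate's `kappa`), `0 ≤ κ`, the hulls
    (c κ' : ℝ) (hκc : κ' * c = h) (hκ' : 0 ≤ κ') (μlo μhi xlo xhi E0lo E0hi : ℝ)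
    -- the `H̃`-sweep (field `h`)
    (Mo : Fin (a * b) → QState (a * b) → QState (a * b) → ℝ) (hMo0 : ∀ k b' c', 0 ≤ Mo k b' c')
    (hMorow : ∀ k b' c' s, ∑ s', ‖quadAutomaton (dGammaHop (orbPullback e
      (Matrix.of fun i j => star (g i) * g j * w5Nambu a b μ h i j))) (fun _ _ _ _ => 0)
      (quadOnSite (Matrix.of fun i j => star (g i) * g j * w5Nambu a b μ h i j) U μ e) k b' c' s s'‖ ≤ Mo k b' c')
    (hMocol : ∀ k b' c' s', ∑ s, ‖quadAutomaton (dGammaHop (orbPullback e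
      (Matrix.of fun i j => star (g i) * g j * w5Nambu a b μ h i j))) (fun _ _ _ _ => 0)
      (quadOnSite (Matrix.of fun i j => star (g i) * g j * w5Nambu a b μ h i j) U μ e) k b' c' s s'‖ ≤ Mo k b' c')
    (YH : Fin (a * b + 1) → QState (a * b) → Matrix (Fin D) (Fin D) ℂ) (ρH : Fin (a * b) → QState (a * b) → ℝ)
    (hρH : ∀ (k : Fin (a * b)) (c' : QState (a * b)),
      ‖YH k.succ c' - ∑ b', transferOp (A k) (quadAutomaton (dGammaHop (orbPullback e
      (Matrix.of fun i j => star (g i) * g j * w5Nambu a b μ h i j))) (fun _ _ _ _ => 0)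
      (quadOnSite (Matrix.of fun i j => star (g i) * g j * w5Nambu a b μ h i j) U μ e) k b' c')
        (YH k.castSucc b')‖ ≤ ρH k c')
    (radH : Fin (a * b + 1) → QState (a * b) → ℝ)
    (hradH0 : ∀ b', ‖YH 0 b' -
      (Pi.single QState.start (vecMulVec (star l) l) : QState (a * b) → Matrix (Fin D) (Fin D) ℂ) b'‖ ≤ radH 0 b')
    (hradH : ∀ (k : Fin (a * b)) (c' : QState (a * b)),
      ∑ b', Mo k b' c' * κ k * radH k.castSucc b' + ρH k c' ≤ radH k.succ c')
    -- the `𝒳`-sweep (the transformed pair word)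
    (Mx : Fin (a * b) → QState (a * b) → QState (a * b) → ℝ) (hMx0 : ∀ k b' c', 0 ≤ Mx k b' c')
    (hMxrow : ∀ k b' c' s, ∑ s', ‖quadAutomaton (dGammaHop (orbPullback e
      (Matrix.of fun i j => star (g i) * g j * (w5Nambu a b μ 0 i j - w5Nambu a b μ c i j)))) (fun _ _ _ _ => 0)
      (quadOnSite (Matrix.of fun i j => star (g i) * g j * (w5Nambu a b μ 0 i j - w5Nambu a b μ c i j)) 0 0 e) k b' c' s s'‖ ≤ Mx k b' c')
    (hMxcol : ∀ k b' c' s', ∑ s, ‖quadAutomaton (dGammaHop (orbPullback e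
      (Matrix.of fun i j => star (g i) * g j * (w5Nambu a b μ 0 i j - w5Nambu a b μ c i j)))) (fun _ _ _ _ => 0)
      (quadOnSite (Matrix.of fun i j => star (g i) * g j * (w5Nambu a b μ 0 i j - w5Nambu a b μ c i j)) 0 0 e) k b' c' s s'‖ ≤ Mx k b' c')
    (YX : Fin (a * b + 1) → QState (a * b) → Matrix (Fin D) (Fin D) ℂ) (ρX : Fin (a * b) → QState (a * b) → ℝ)
    (hρX : ∀ (k : Fin (a * b)) (c' : QState (a * b)),
      ‖YX k.succ c' - ∑ b', transferOp (A k) (quadAutomaton (dGammaHop (orbPullback e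
      (Matrix.of fun i j => star (g i) * g j * (w5Nambu a b μ 0 i j - w5Nambu a b μ c i j)))) (fun _ _ _ _ => 0)
      (quadOnSite (Matrix.of fun i j => star (g i) * g j * (w5Nambu a b μ 0 i j - w5Nambu a b μ c i j)) 0 0 e) k b' c')
        (YX k.castSucc b')‖ ≤ ρX k c')
    (radX : Fin (a * b + 1) → QState (a * b) → ℝ)
    (hradX0 : ∀ b', ‖YX 0 b' -
      (Pi.single QState.start (vecMulVec (star l) l) : QState (a * b) → Matrix (Fin D) (Fin D) ℂ) b'‖ ≤ radX 0 b')
    (hradX : ∀ (k : Fin (a * b)) (c' : QState (a * b)),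
      ∑ b', Mx k b' c' * κ k * radX k.castSucc b' + ρX k c' ≤ radX k.succ c')
    -- the `Nrm`-sweep (shared)
    (YN : Fin (a * b + 1) → Matrix (Fin D) (Fin D) ℂ) (ρN : Fin (a * b) → ℝ)
    (hρN : ∀ k : Fin (a * b), ‖YN k.succ - transferOp (A k) 1 (YN k.castSucc)‖ ≤ ρN k)
    (radN : Fin (a * b + 1) → ℝ) (hrN0 : ‖YN 0 - vecMulVec (star l) l‖ ≤ radN 0)
    (hrN : ∀ k : Fin (a * b), 1 * κ k * radN k.castSucc + ρN k ≤ radN k.succ)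
    -- the four corner tests of the `H̃` hull and of the `𝒳` hull
    (hm1 : μlo * ((star r ⬝ᵥ (YN (Fin.last (a * b)) *ᵥ r)).re - (∑ i, ‖r i‖) * (∑ i, ‖r i‖) * radN (Fin.last (a * b))) ≤
      (star r ⬝ᵥ (YH (Fin.last (a * b)) QState.fin *ᵥ r)).re - (∑ i, ‖r i‖) * (∑ i, ‖r i‖) * radH (Fin.last (a * b)) QState.fin)
    (hm2 : μlo * ((star r ⬝ᵥ (YN (Fin.last (a * b)) *ᵥ r)).re + (∑ i, ‖r i‖) * (∑ i, ‖r i‖) * radN (Fin.last (a * b))) ≤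
      (star r ⬝ᵥ (YH (Fin.last (a * b)) QState.fin *ᵥ r)).re - (∑ i, ‖r i‖) * (∑ i, ‖r i‖) * radH (Fin.last (a * b)) QState.fin)
    (hm3 : (star r ⬝ᵥ (YH (Fin.last (a * b)) QState.fin *ᵥ r)).re +
        (∑ i, ‖r i‖) * (∑ i, ‖r i‖) * radH (Fin.last (a * b)) QState.fin ≤
      μhi * ((star r ⬝ᵥ (YN (Fin.last (a * b)) *ᵥ r)).re - (∑ i, ‖r i‖) * (∑ i, ‖r i‖) * radN (Fin.last (a * b))))
    (hm4 : (star r ⬝ᵥ (YH (Fin.last (a * b)) QState.fin *ᵥ r)).re +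
        (∑ i, ‖r i‖) * (∑ i, ‖r i‖) * radH (Fin.last (a * b)) QState.fin ≤
      μhi * ((star r ⬝ᵥ (YN (Fin.last (a * b)) *ᵥ r)).re + (∑ i, ‖r i‖) * (∑ i, ‖r i‖) * radN (Fin.last (a * b))))
    (hx1 : xlo * ((star r ⬝ᵥ (YN (Fin.last (a * b)) *ᵥ r)).re - (∑ i, ‖r i‖) * (∑ i, ‖r i‖) * radN (Fin.last (a * b))) ≤
      (star r ⬝ᵥ (YX (Fin.last (a * b)) QState.fin *ᵥ r)).re - (∑ i, ‖r i‖) * (∑ i, ‖r i‖) * radX (Fin.last (a * b)) QState.fin)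
    (hx2 : xlo * ((star r ⬝ᵥ (YN (Fin.last (a * b)) *ᵥ r)).re + (∑ i, ‖r i‖) * (∑ i, ‖r i‖) * radN (Fin.last (a * b))) ≤
      (star r ⬝ᵥ (YX (Fin.last (a * b)) QState.fin *ᵥ r)).re - (∑ i, ‖r i‖) * (∑ i, ‖r i‖) * radX (Fin.last (a * b)) QState.fin)
    (hx3 : (star r ⬝ᵥ (YX (Fin.last (a * b)) QState.fin *ᵥ r)).re +
        (∑ i, ‖r i‖) * (∑ i, ‖r i‖) * radX (Fin.last (a * b)) QState.fin ≤
      xhi * ((star r ⬝ᵥ (YN (Fin.last (a * b)) *ᵥ r)).re - (∑ i, ‖r i‖) * (∑ i, ‖r i‖) * radN (Fin.last (a * b))))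
    (hx4 : (star r ⬝ᵥ (YX (Fin.last (a * b)) QState.fin *ᵥ r)).re +
        (∑ i, ‖r i‖) * (∑ i, ‖r i‖) * radX (Fin.last (a * b)) QState.fin ≤
      xhi * ((star r ⬝ᵥ (YN (Fin.last (a * b)) *ᵥ r)).re + (∑ i, ‖r i‖) * (∑ i, ‖r i‖) * radN (Fin.last (a * b))))
    -- the two by-value literal tests of `E_zero_field = μ̃ + κ·X` against the row's edges
    (hz1 : E0lo ≤ μlo + κ' * xlo) (hz2 : μhi + κ' * xhi ≤ E0hi) :
    let Ψ : TensorIndex (Fin a ×ₗ Fin b) 4 → ℂ := fun k => mpsOpenVar (a * b) A l r (fun i => k (e i))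
    E0lo * (star (toSpinVec.symm Ψ) ⬝ᵥ toSpinVec.symm Ψ).re ≤
        (star (toSpinVec.symm Ψ) ⬝ᵥ
          (((partialParticleHole (spinDownOrbitals : Finset (Orb (Fin a ×ₗ Fin b))) * orbitalPhase g)ᴴ *
              dWaveSourceOpenBox a b U μ 0 *
              (partialParticleHole (spinDownOrbitals : Finset (Orb (Fin a ×ₗ Fin b))) * orbitalPhase g)) *ᵥ
            toSpinVec.symm Ψ)).re ∧
      (star (toSpinVec.symm Ψ) ⬝ᵥ
          (((partialParticleHole (spinDownOrbitals : Finset (Orb (Fin a ×ₗ Fin b))) * orbitalPhase g)ᴴ *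
              dWaveSourceOpenBox a b U μ 0 *
              (partialParticleHole (spinDownOrbitals : Finset (Orb (Fin a ×ₗ Fin b))) * orbitalPhase g)) *ᵥ
            toSpinVec.symm Ψ)).re ≤
        E0hi * (star (toSpinVec.symm Ψ) ⬝ᵥ toSpinVec.symm Ψ).re := by
  intro Ψ
  have hg' : ∀ i, ‖g i‖ = 1 := fun i => by rcases hg i with h1 | h1 <;> simp [h1]
  have WH := quadraticWindow_of_reader (Matrix.of fun i j => star (g i) * g j * w5Nambu a b μ h i j)
    (gaugedNambu_symm_of_sign μ h hg) U μ e he A l r κ hκ0 hκ Mo hMo0 hMorow hMocol YH ρH hρH radH hradH0 hradH YN ρN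
    hρN radN hrN0 hrN μlo μhi hm1 hm2 hm3 hm4
  have WX := quadraticWindow_of_reader (Matrix.of fun i j => star (g i) * g j * (w5Nambu a b μ 0 i j - w5Nambu a b μ c i j))
    (gaugedNambuDiff_symm_of_sign μ c hg) 0 0 e he A l r κ hκ0 hκ Mx hMx0 hMxrow hMxcol YX ρX hρX radX hradX0 hradX
    YN ρN hρN radN hrN0 hrN xlo xhi hx1 hx2 hx3 hx4
  simp only [Complex.ofReal_zero, zero_mul, zero_smul, sub_zero, add_zero] at WX
  have hR : 0 ≤ (star (toSpinVec.symm Ψ) ⬝ᵥ toSpinVec.symm Ψ).re :=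
    (Complex.nonneg_iff.mp (dotProduct_star_self_nonneg _)).1
  rw [conjTranspose_dWaveSourceOpenBox_zero_eq U μ h c κ' hκc hg',
    gaugedShiba'_conjTranspose_conj_dWaveSourceOpenBox a b U μ h hg', add_mulVec, dotProduct_add, Complex.add_re,
    smul_mulVec, dotProduct_smul, smul_eq_mul, Complex.re_ofReal_mul]
  have h1 := mul_le_mul_of_nonneg_right hz1 hR
  have h2 := mul_le_mul_of_nonneg_left WX.1 hκ'
  have h3 := mul_le_mul_of_nonneg_right hz2 hR
  have h4 := mul_le_mul_of_nonneg_left WX.2 hκ'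
  constructor
  · linarith [h1, h2, WH.1]
  · linarith [h3, h4, WH.2]

end Merge

/-! ## §Q3  The derived zero-field window, embed layout -/

section Embed

variable {a b N D : ℕ}

/-- **`E0 = μ̃ + κ·X` from the EMBED-layout bytes** (producers' frame, `g i = ±1`): the `H̃`-sweep and the `𝒳`-sweep
over part 34's dilated tables (`(𝓗^ḡ, U, μ)` and `(𝒳, 0, 0)`), the shared `Nrm` sweep, the zero dummy slices, the
eight corner tests, `κ·c = h`, `0 ≤ κ`, the literal tests ⟹ the zero-field rows `h0lo`/`h0hi` of part 39 for the
un-dilated witness `ψ̃ = undilate e′ (mpsOpenVar N A l r)`. -/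
theorem zeroFieldWindow_of_embedReader_derived (U μ h : ℝ) {g : Orb (Fin a ×ₗ Fin b) → ℂ}
    (hg : ∀ i, g i = 1 ∨ g i = -1) (e' : Fin N ≃ Orb (Fin a ×ₗ Fin b))
    (he' : ∀ i j, e' i < e' j ↔ i < j) (A : Fin N → MPSTensor 4 D) (hA2 : ∀ j, A j 2 = 0) (hA3 : ∀ j, A j 3 = 0)
    (l r : Fin D → ℂ) (κ : Fin N → ℝ) (hκ0 : ∀ k, 0 ≤ κ k)
    (hκ : ∀ k (z : EuclideanSpace ℂ (Fin D)), ∑ s, ‖toLp 2 (A k s *ᵥ ofLp z)‖ ^ 2 ≤ κ k * ‖z‖ ^ 2)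
    -- the reader's scalars: `κ·c = h` (record: `c = 1/√2`, `κ` = the certificate's `kappa`), `0 ≤ κ`, the hulls
    (c κ' : ℝ) (hκc : κ' * c = h) (hκ' : 0 ≤ κ') (μlo μhi xlo xhi E0lo E0hi : ℝ)
    -- the `H̃`-sweep (field `h`) over the dilated tables
    (Mo : Fin N → QState N → QState N → ℝ) (hMo0 : ∀ k b' c', 0 ≤ Mo k b' c')
    (hMorow : ∀ k b' c' s, ∑ s', ‖quadAutomaton (dGammaHop (orbPullback e' (dilMatrix
      (Matrix.of fun i j => star (g i) * g j * w5Nambu a b μ h i j)))) (dilNN U e') (dilOnSite (Matrix.of fun i j => star (g i) * g j * w5Nambu a b μ h i j) U μ e') k b' c' s s'‖ ≤ Mo k b' c')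
    (hMocol : ∀ k b' c' s', ∑ s, ‖quadAutomaton (dGammaHop (orbPullback e' (dilMatrix
      (Matrix.of fun i j => star (g i) * g j * w5Nambu a b μ h i j)))) (dilNN U e') (dilOnSite (Matrix.of fun i j => star (g i) * g j * w5Nambu a b μ h i j) U μ e') k b' c' s s'‖ ≤ Mo k b' c')
    (YH : Fin (N + 1) → QState N → Matrix (Fin D) (Fin D) ℂ) (ρH : Fin N → QState N → ℝ)
    (hρH : ∀ (k : Fin N) (c' : QState N),
      ‖YH k.succ c' - ∑ b', transferOp (A k) (quadAutomaton (dGammaHop (orbPullback e' (dilMatrix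
      (Matrix.of fun i j => star (g i) * g j * w5Nambu a b μ h i j)))) (dilNN U e') (dilOnSite (Matrix.of fun i j => star (g i) * g j * w5Nambu a b μ h i j) U μ e') k b' c') (YH k.castSucc b')‖ ≤ ρH k c')
    (radH : Fin (N + 1) → QState N → ℝ)
    (hradH0 : ∀ b', ‖YH 0 b' -
      (Pi.single QState.start (vecMulVec (star l) l) : QState N → Matrix (Fin D) (Fin D) ℂ) b'‖ ≤ radH 0 b')
    (hradH : ∀ (k : Fin N) (c' : QState N), ∑ b', Mo k b' c' * κ k * radH k.castSucc b' + ρH k c' ≤ radH k.succ c')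
    -- the `𝒳`-sweep over the dilated tables
    (Mx : Fin N → QState N → QState N → ℝ) (hMx0 : ∀ k b' c', 0 ≤ Mx k b' c')
    (hMxrow : ∀ k b' c' s, ∑ s', ‖quadAutomaton (dGammaHop (orbPullback e' (dilMatrix
      (Matrix.of fun i j => star (g i) * g j * (w5Nambu a b μ 0 i j - w5Nambu a b μ c i j))))) (dilNN 0 e') (dilOnSite (Matrix.of fun i j => star (g i) * g j * (w5Nambu a b μ 0 i j - w5Nambu a b μ c i j)) 0 0 e') k b' c' s s'‖ ≤ Mx k b' c')
    (hMxcol : ∀ k b' c' s', ∑ s, ‖quadAutomaton (dGammaHop (orbPullback e' (dilMatrix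
      (Matrix.of fun i j => star (g i) * g j * (w5Nambu a b μ 0 i j - w5Nambu a b μ c i j))))) (dilNN 0 e') (dilOnSite (Matrix.of fun i j => star (g i) * g j * (w5Nambu a b μ 0 i j - w5Nambu a b μ c i j)) 0 0 e') k b' c' s s'‖ ≤ Mx k b' c')
    (YX : Fin (N + 1) → QState N → Matrix (Fin D) (Fin D) ℂ) (ρX : Fin N → QState N → ℝ)
    (hρX : ∀ (k : Fin N) (c' : QState N),
      ‖YX k.succ c' - ∑ b', transferOp (A k) (quadAutomaton (dGammaHop (orbPullback e' (dilMatrix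
      (Matrix.of fun i j => star (g i) * g j * (w5Nambu a b μ 0 i j - w5Nambu a b μ c i j))))) (dilNN 0 e') (dilOnSite (Matrix.of fun i j => star (g i) * g j * (w5Nambu a b μ 0 i j - w5Nambu a b μ c i j)) 0 0 e') k b' c') (YX k.castSucc b')‖ ≤ ρX k c')
    (radX : Fin (N + 1) → QState N → ℝ)
    (hradX0 : ∀ b', ‖YX 0 b' -
      (Pi.single QState.start (vecMulVec (star l) l) : QState N → Matrix (Fin D) (Fin D) ℂ) b'‖ ≤ radX 0 b')
    (hradX : ∀ (k : Fin N) (c' : QState N), ∑ b', Mx k b' c' * κ k * radX k.castSucc b' + ρX k c' ≤ radX k.succ c')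
    -- the `Nrm`-sweep (shared)
    (YN : Fin (N + 1) → Matrix (Fin D) (Fin D) ℂ) (ρN : Fin N → ℝ)
    (hρN : ∀ k : Fin N, ‖YN k.succ - transferOp (A k) 1 (YN k.castSucc)‖ ≤ ρN k)
    (radN : Fin (N + 1) → ℝ) (hrN0 : ‖YN 0 - vecMulVec (star l) l‖ ≤ radN 0)
    (hrN : ∀ k : Fin N, 1 * κ k * radN k.castSucc + ρN k ≤ radN k.succ)
    -- the four corner tests of the `H̃` hull and of the `𝒳` hull
    (hm1 : μlo * ((star r ⬝ᵥ (YN (Fin.last N) *ᵥ r)).re - (∑ i, ‖r i‖) * (∑ i, ‖r i‖) * radN (Fin.last N)) ≤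
      (star r ⬝ᵥ (YH (Fin.last N) QState.fin *ᵥ r)).re - (∑ i, ‖r i‖) * (∑ i, ‖r i‖) * radH (Fin.last N) QState.fin)
    (hm2 : μlo * ((star r ⬝ᵥ (YN (Fin.last N) *ᵥ r)).re + (∑ i, ‖r i‖) * (∑ i, ‖r i‖) * radN (Fin.last N)) ≤
      (star r ⬝ᵥ (YH (Fin.last N) QState.fin *ᵥ r)).re - (∑ i, ‖r i‖) * (∑ i, ‖r i‖) * radH (Fin.last N) QState.fin)
    (hm3 : (star r ⬝ᵥ (YH (Fin.last N) QState.fin *ᵥ r)).re +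
        (∑ i, ‖r i‖) * (∑ i, ‖r i‖) * radH (Fin.last N) QState.fin ≤
      μhi * ((star r ⬝ᵥ (YN (Fin.last N) *ᵥ r)).re - (∑ i, ‖r i‖) * (∑ i, ‖r i‖) * radN (Fin.last N)))
    (hm4 : (star r ⬝ᵥ (YH (Fin.last N) QState.fin *ᵥ r)).re +
        (∑ i, ‖r i‖) * (∑ i, ‖r i‖) * radH (Fin.last N) QState.fin ≤
      μhi * ((star r ⬝ᵥ (YN (Fin.last N) *ᵥ r)).re + (∑ i, ‖r i‖) * (∑ i, ‖r i‖) * radN (Fin.last N)))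
    (hx1 : xlo * ((star r ⬝ᵥ (YN (Fin.last N) *ᵥ r)).re - (∑ i, ‖r i‖) * (∑ i, ‖r i‖) * radN (Fin.last N)) ≤
      (star r ⬝ᵥ (YX (Fin.last N) QState.fin *ᵥ r)).re - (∑ i, ‖r i‖) * (∑ i, ‖r i‖) * radX (Fin.last N) QState.fin)
    (hx2 : xlo * ((star r ⬝ᵥ (YN (Fin.last N) *ᵥ r)).re + (∑ i, ‖r i‖) * (∑ i, ‖r i‖) * radN (Fin.last N)) ≤
      (star r ⬝ᵥ (YX (Fin.last N) QState.fin *ᵥ r)).re - (∑ i, ‖r i‖) * (∑ i, ‖r i‖) * radX (Fin.last N) QState.fin)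
    (hx3 : (star r ⬝ᵥ (YX (Fin.last N) QState.fin *ᵥ r)).re +
        (∑ i, ‖r i‖) * (∑ i, ‖r i‖) * radX (Fin.last N) QState.fin ≤
      xhi * ((star r ⬝ᵥ (YN (Fin.last N) *ᵥ r)).re - (∑ i, ‖r i‖) * (∑ i, ‖r i‖) * radN (Fin.last N)))
    (hx4 : (star r ⬝ᵥ (YX (Fin.last N) QState.fin *ᵥ r)).re +
        (∑ i, ‖r i‖) * (∑ i, ‖r i‖) * radX (Fin.last N) QState.fin ≤
      xhi * ((star r ⬝ᵥ (YN (Fin.last N) *ᵥ r)).re + (∑ i, ‖r i‖) * (∑ i, ‖r i‖) * radN (Fin.last N)))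
    -- the two by-value literal tests of `E_zero_field = μ̃ + κ·X` against the row's edges
    (hz1 : E0lo ≤ μlo + κ' * xlo) (hz2 : μhi + κ' * xhi ≤ E0hi) :
    E0lo * (star (undilate e' (mpsOpenVar N A l r)) ⬝ᵥ undilate e' (mpsOpenVar N A l r)).re ≤
        (star (undilate e' (mpsOpenVar N A l r)) ⬝ᵥ
          (((partialParticleHole (spinDownOrbitals : Finset (Orb (Fin a ×ₗ Fin b))) * orbitalPhase g)ᴴ *
              dWaveSourceOpenBox a b U μ 0 *
              (partialParticleHole (spinDownOrbitals : Finset (Orb (Fin a ×ₗ Fin b))) * orbitalPhase g)) *ᵥ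
            undilate e' (mpsOpenVar N A l r))).re ∧
      (star (undilate e' (mpsOpenVar N A l r)) ⬝ᵥ
          (((partialParticleHole (spinDownOrbitals : Finset (Orb (Fin a ×ₗ Fin b))) * orbitalPhase g)ᴴ *
              dWaveSourceOpenBox a b U μ 0 *
              (partialParticleHole (spinDownOrbitals : Finset (Orb (Fin a ×ₗ Fin b))) * orbitalPhase g)) *ᵥ
            undilate e' (mpsOpenVar N A l r))).re ≤
        E0hi * (star (undilate e' (mpsOpenVar N A l r)) ⬝ᵥ undilate e' (mpsOpenVar N A l r)).re := by
  have hg' : ∀ i, ‖g i‖ = 1 := fun i => by rcases hg i with h1 | h1 <;> simp [h1]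
  have hsupp := mpsOpenVar_eq_zero_of_dummy A l r hA2 hA3
  -- the `H̃` window on the chain, then un-dilated
  have hHc := wordSum_window_of_reader _ _ _ A l r κ hκ0 hκ Mo hMo0 hMorow hMocol YH ρH hρH radH hradH0 hradH YN ρN hρN
    radN hrN0 hrN μlo μhi hm1 hm2 hm3 hm4
  have WH : μlo * (star (undilate e' (mpsOpenVar N A l r)) ⬝ᵥ undilate e' (mpsOpenVar N A l r)).re ≤
      (star (undilate e' (mpsOpenVar N A l r)) ⬝ᵥ
        (((partialParticleHole (spinDownOrbitals : Finset (Orb (Fin a ×ₗ Fin b))) * orbitalPhase g)ᴴ *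
            dWaveSourceOpenBox a b U μ h *
            (partialParticleHole (spinDownOrbitals : Finset (Orb (Fin a ×ₗ Fin b))) * orbitalPhase g)) *ᵥ
          undilate e' (mpsOpenVar N A l r))).re ∧
      (star (undilate e' (mpsOpenVar N A l r)) ⬝ᵥ
        (((partialParticleHole (spinDownOrbitals : Finset (Orb (Fin a ×ₗ Fin b))) * orbitalPhase g)ᴴ *
            dWaveSourceOpenBox a b U μ h *
            (partialParticleHole (spinDownOrbitals : Finset (Orb (Fin a ×ₗ Fin b))) * orbitalPhase g)) *ᵥ
          undilate e' (mpsOpenVar N A l r))).re ≤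
      μhi * (star (undilate e' (mpsOpenVar N A l r)) ⬝ᵥ undilate e' (mpsOpenVar N A l r)).re := by
    rw [gaugedShiba'_conjTranspose_conj_dWaveSourceOpenBox (a := a) (b := b) U μ h hg',
      undilate_sandwich e' _ hsupp, jwEmbed_dilOrb_quadratic,
      inner_dilQuadratic_eq_quadWordSum _ (gaugedNambu_symm_of_sign μ h hg) U μ e' he', undilate_norm e' _ hsupp]
    exact hHc
  -- the `𝒳` window on the chain, then un-dilated
  have hXc := wordSum_window_of_reader _ _ _ A l r κ hκ0 hκ Mx hMx0 hMxrow hMxcol YX ρX hρX radX hradX0 hradX YN ρN hρN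
    radN hrN0 hrN xlo xhi hx1 hx2 hx3 hx4
  have emb := jwEmbed_dilOrb_quadratic (a := a) (b := b)
    (Matrix.of fun i j => star (g i) * g j * (w5Nambu a b μ 0 i j - w5Nambu a b μ c i j)) 0 0
  have key := inner_dilQuadratic_eq_quadWordSum
    (Matrix.of fun i j => star (g i) * g j * (w5Nambu a b μ 0 i j - w5Nambu a b μ c i j))
    (gaugedNambuDiff_symm_of_sign μ c hg) 0 0 e' he' (mpsOpenVar N A l r)
  simp only [Complex.ofReal_zero, zero_mul, zero_smul, sub_zero, add_zero] at emb key
  have WX : xlo * (star (undilate e' (mpsOpenVar N A l r)) ⬝ᵥ undilate e' (mpsOpenVar N A l r)).re ≤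
      (star (undilate e' (mpsOpenVar N A l r)) ⬝ᵥ
        (dGamma (Matrix.of fun i j => star (g i) * g j * (w5Nambu a b μ 0 i j - w5Nambu a b μ c i j)) *ᵥ
          undilate e' (mpsOpenVar N A l r))).re ∧
      (star (undilate e' (mpsOpenVar N A l r)) ⬝ᵥ
        (dGamma (Matrix.of fun i j => star (g i) * g j * (w5Nambu a b μ 0 i j - w5Nambu a b μ c i j)) *ᵥ
          undilate e' (mpsOpenVar N A l r))).re ≤
      xhi * (star (undilate e' (mpsOpenVar N A l r)) ⬝ᵥ undilate e' (mpsOpenVar N A l r)).re := by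
    rw [undilate_sandwich e' _ hsupp, emb, key, undilate_norm e' _ hsupp]
    exact hXc
  have hR : 0 ≤ (star (undilate e' (mpsOpenVar N A l r)) ⬝ᵥ undilate e' (mpsOpenVar N A l r)).re :=
    (Complex.nonneg_iff.mp (dotProduct_star_self_nonneg _)).1
  rw [conjTranspose_dWaveSourceOpenBox_zero_eq U μ h c κ' hκc hg', add_mulVec, dotProduct_add, Complex.add_re,
    smul_mulVec, dotProduct_smul, smul_eq_mul, Complex.re_ofReal_mul]
  have h1 := mul_le_mul_of_nonneg_right hz1 hR
  have h2 := mul_le_mul_of_nonneg_left WX.1 hκ'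
  have h3 := mul_le_mul_of_nonneg_right hz2 hR
  have h4 := mul_le_mul_of_nonneg_left WX.2 hκ'
  constructor
  · linarith [h1, h2, WH.1]
  · linarith [h3, h4, WH.2]

end Embed

end Summit.Ventures.CertifiedManyBodySolver.Upper.IntervalReader

end
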